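import Literature.Barriers.RiemannHypothesis.NymanBeurlingObstructionsProofs
import Literature.Barriers.RiemannHypothesis.NymanBeurlingObstructionsBDBLSProofs
import Literature.NumberTheory.LFunctions.BaezDuarteIsometry
import HarnessLib

/-!
# Báez-Duarte 2000, Proposition 4.5 — proved: `‖χ + S_n‖₂ ≥ max( (C/√n)|M(n)+2| , |g(n)|√n )`

Barrier catalogue `Literature/Barriers/RiemannHypothesis/`, third companion ("Proofs") file of
`NymanBeurlingObstructions.lean` (after `NymanBeurlingObstructionsProofs.lean`, Prop. 4.4 and the
BDBLS `liminf` bound, and `NymanBeurlingObstructionsBDBLSProofs.lean`, the uniform BDBLS bound). It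
discharges the vendored fact

* `Literature.Barriers.RiemannHypothesis.BaezDuarte2000_prop4_5` — "There exists a constant `C > 0`
  such that `‖χ + S_n‖₂ ≥ max( C n^{-1/2} |M(n) + 2|, |g(n)| √n )`" (`S_n = ∑_{k ≤ n} μ(k)ρ(1/(kx))`,
  `M` the Mertens function, `g(n) = ∑_{k ≤ n} μ(k)/k`),

as `Literature.Barriers.RiemannHypothesis.BaezDuarte2000_prop4_5_holds`, fully proved (no named
fact is assumed; axioms `propext`, `Classical.choice`, `Quot.sound`), with the explicit constant
`C = 1/√32`.

## Source and printed proof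

L. Báez-Duarte, *Arithmetical aspects of Beurling's real variable reformulation of the Riemann
hypothesis*, arXiv:math/0011254 (2000), §4.2, p. 11, Proposition 4.5 with proof:
"For `p = 2` inequality (4.6) translates into `‖χ + S_n‖₂ ≥ |g(n)|√n` (4.7). On the other hand if
we apply `U` to `S_n` we get `US_n(x) = M(n)`, (`0 < x < 1/n`) (4.8). Hence
`‖χ + S_n‖₂² ≥ ∫_0^{1/n} |(1/(πx)) sin(2πx) + M(n)|² dx` (4.9), and
`‖χ + S_n‖₂ ≥ C n^{-1/2}|M(n) + 2|` (4.10), for some positive constant `C`." Here `U` is the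
dilation-invariant unitary operator of `L²(0,∞)` of [IUO] (Báez-Duarte 1999) with
`UK_a = K_aU`, `Uρ₁(x) = ρ(x)/x`, `Uχ(x) = sin(2πx)/(πx)` ((4.2)–(4.4), p. 10).

## The argument here (same mechanism; `U` through the tree's Mellin–Plancherel isometry)

* The second half `‖χ + S_n‖₂ ≥ |g(n)|√n` is the tree's
  `Literature.Barriers.RiemannHypothesis.ofReal_moebiusHarmonic_le_naturalError`
  (`NymanBeurlingObstructionsProofs.lean`, from `χ + S_n = g(n)/x` on `(1/n, ∞)`).
* For the first half, `χ + S_n` is the tree's `nbFun a c` with the natural dilations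
  `a_j = j + 1` and coefficients `c_j = -μ(j+1)` (`naturalError_eq_genError`, `rfl`, and
  `BDBLS2000.genError_eq`: `genError a c = ofReal √(∫_0^∞ |nbFun a c|²)`); its reflection
  `U(χ + S_n)` is `nbDual a c = sin(2πt)/(πt) - ∑_j c_j {a_j t}/(a_j t)`
  (`Literature/NumberTheory/LFunctions/BaezDuarteIsometry.lean`), and "`U` is unitary" is the tree's
  `Literature.NumberTheory.LFunctions.BaezDuarteU.integral_norm_sq_nbDual_eq`:
  `∫_0^∞ |nbDual|² = ∫_0^∞ |nbFun|²` (Mellin–Plancherel on both sides, `|U(1/2+iτ)| = 1`).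
* (4.8) (`nbDual_natural_eq`): for `0 < t` with `nt < 1`, every `{a_j t}/(a_j t) = 1`, so
  `nbDual a c t = sin(2πt)/(πt) - ∑_j c_j = sin(2πt)/(πt) + M(n)`.
* (4.9)–(4.10) with an explicit constant (`integral_Ioc_norm_sq_sincKernel_add_ge`): on
  `(0, δ]`, `δ = 1/(8n)`, with `y = 2πt`, `s = M(n) + 2`, `d = 2 - 2 sin(y)/y`: Mathlib's
  `sin y ≤ y` and `y - y³/6 < sin y` give `0 ≤ d ≤ y²/3`, hence
  `|sin(2πt)/(πt) + M(n)|² = (s - d)² ≥ s²/2 - d² ≥ s²/2 - (16π⁴/9)δ⁴`; integrating,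
  `∫_0^δ ≥ δ(s²/2 - (16π⁴/9)δ⁴) ≥ s²/(32n)` because `s` is an integer (`s = 0` is trivial, else
  `s² ≥ 1`) and `16π⁴/9 ≤ 456` (`π ≤ 4`). Hence `∫_0^∞|χ + S_n|² ≥ (M(n)+2)²/(32n)`, i.e.
  `‖χ + S_n‖₂ ≥ (1/√32) n^{-1/2} |M(n)+2|`.

## References

* [BaezDuarte2000] L. Báez-Duarte, *Arithmetical aspects of Beurling's real variable reformulation
  of the Riemann hypothesis*, arXiv:math/0011254 (2000), §4.2 p. 11, Prop. 4.5 with proof,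
  (4.2)–(4.4) p. 10 (read).
* [IUO] L. Báez-Duarte, *A class of invariant unitary operators*, Adv. Math. 144 (1999), 1–12
  (the operator `U`; realised in the tree through `BaezDuarteReflection.lean` /
  `BaezDuarteIsometry.lean`).
* [Burnol2002] J.-F. Burnol, Adv. Math. 170 (2002), 56–70, §3 (`U` as a Mellin multiplier).
-/

noncomputable section

open Complex MeasureTheory Set Filter
open scoped Real Topology ArithmeticFunction.Moebius
open Literature.NumberTheory.LFunctions Literature.NumberTheory.LFunctions.BaezDuarteU
  Literature.Analysis.SpecialFunctions

namespace Literature.Barriers.RiemannHypothesis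

namespace BaezDuarte2000Prop45

/-! ## `χ + S_n` as the tree's `nbFun` with the natural dilations -/

/-- `naturalError n = genError (k ↦ k+1) (naturalCoeff n)`: the natural dilations are
`a_j = j + 1`, `j < n` (definitional). [cite: BaezDuarte2000, §1.2 (1.12)] -/
theorem naturalError_eq_genError (n : ℕ) :
    naturalError n = genError (fun k : Fin n ↦ ((k : ℕ) : ℝ) + 1) (naturalCoeff n) :=
  rfl

/-- `1 ≤ a_j = j + 1` for the natural dilations. [folklore] -/
theorem one_le_natDil (n : ℕ) (j : Fin n) : (1 : ℝ) ≤ ((j : ℕ) : ℝ) + 1 :=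
  (natDilation_bounds n j).1

/-- `∑_{j<n} c_j = -M(n)` for the natural coefficients `c_j = -μ(j+1)` (`M` the Mertens function).
[folklore] -/
theorem sum_naturalCoeff (n : ℕ) :
    ∑ j : Fin n, naturalCoeff n j = -((mertensFunction n : ℤ) : ℝ) := by
  rw [MertensDictionary.mertensFunction_natCast]
  simp only [naturalCoeff]
  rw [Fin.sum_univ_eq_sum_range (fun j ↦ -(μ (j + 1) : ℝ)) n]
  push_cast
  rw [← Finset.sum_neg_distrib]
  induction n with
  | zero => simp
  | succ n ih =>
    rw [Finset.sum_range_succ, ih, Finset.sum_Ioc_succ_top (Nat.zero_le n)]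

/-- **`US_n = M(n)` on `(0, 1/n)`** (Báez-Duarte 2000, (4.8)): for `0 < t` with `nt < 1` every
`{a_j t}/(a_j t)` equals `1` (`a_j ≤ n`), so
`U(χ + S_n)(t) = sin(2πt)/(πt) - ∑_j c_j = sin(2πt)/(πt) + M(n)`. [cite: BaezDuarte2000, Prop. 4.5 (proof, (4.8)), p. 11] -/
theorem nbDual_natural_eq {n : ℕ} {t : ℝ} (ht0 : 0 < t) (htn : (n : ℝ) * t < 1) :
    nbDual (fun k : Fin n ↦ ((k : ℕ) : ℝ) + 1) (naturalCoeff n) t =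
      sincKernel t + ((mertensFunction n : ℤ) : ℂ) := by
  unfold nbDual
  have h1 : ∀ j : Fin n, fractDiv (((j : ℕ) : ℝ) + 1) t = 1 := fun j ↦ by
    refine fractDiv_eq_one (by positivity) ?_
    calc (((j : ℕ) : ℝ) + 1) * t ≤ n * t := by gcongr; exact (natDilation_bounds n j).2
      _ < 1 := htn
  simp_rw [h1, mul_one]
  rw [← Complex.ofReal_sum, sum_naturalCoeff]
  push_cast
  ring

/-! ## The elementary estimate `∫_0^{1/(8n)} |sin(2πt)/(πt) + M|² dt ≥ (M+2)²/(32n)` -/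

/-- Pointwise: for `t > 0` and real `m`, with `y = 2πt`, `0 ≤ 2 - 2 sin(y)/y ≤ y²/3` (Mathlib's
`sin y ≤ y`, `y - y³/6 < sin y`), whence
`|sin(2πt)/(πt) + m|² ≥ (m+2)²/2 - (16π⁴/9) t⁴`. [folklore] -/
theorem norm_sq_sincKernel_add_ge {t : ℝ} (ht : 0 < t) (m : ℝ) :
    (m + 2) ^ 2 / 2 - 16 * π ^ 4 / 9 * t ^ 4 ≤ ‖sincKernel t + (m : ℂ)‖ ^ 2 := by
  have hy : 0 < 2 * π * t := by positivity
  have hnorm : ‖sincKernel t + (m : ℂ)‖ = |2 * Real.sinc (2 * π * t) + m| := by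
    unfold sincKernel
    rw [show (((2 * Real.sinc (2 * π * t) : ℝ) : ℂ) + (m : ℂ)) =
        ((2 * Real.sinc (2 * π * t) + m : ℝ) : ℂ) by push_cast; ring,
      Complex.norm_real, Real.norm_eq_abs]
  rw [hnorm, sq_abs, Real.sinc_of_ne_zero hy.ne']
  set y : ℝ := 2 * π * t with hy_def
  set d : ℝ := 2 - 2 * (Real.sin y / y) with hd_def
  have hsin_le : Real.sin y ≤ y := Real.sin_le hy.le
  have hsin_ge : y - y ^ 3 / 6 < Real.sin y := Real.sin_gt_sub_cube hy
  have hd0 : 0 ≤ d := by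
    have : Real.sin y / y ≤ 1 := (div_le_one hy).2 hsin_le
    rw [hd_def]
    linarith
  have hd1 : d ≤ y ^ 2 / 3 := by
    have : 1 - y ^ 2 / 6 ≤ Real.sin y / y := by
      rw [le_div_iff₀ hy]
      nlinarith
    rw [hd_def]
    linarith
  have hdd : d * d ≤ (y ^ 2 / 3) * (y ^ 2 / 3) := mul_self_le_mul_self hd0 hd1
  have hy4 : (y ^ 2 / 3) * (y ^ 2 / 3) = 16 * π ^ 4 / 9 * t ^ 4 := by
    rw [hy_def]; ring
  have key : (m + 2) ^ 2 / 2 - d * d ≤ (2 * (Real.sin y / y) + m) ^ 2 := by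
    have e : (2 * (Real.sin y / y) + m) ^ 2 - ((m + 2) ^ 2 / 2 - d * d) =
        (m + 2 - 2 * d) ^ 2 / 2 := by
      rw [hd_def]; ring
    nlinarith [sq_nonneg (m + 2 - 2 * d), e]
  calc (m + 2) ^ 2 / 2 - 16 * π ^ 4 / 9 * t ^ 4
      = (m + 2) ^ 2 / 2 - (y ^ 2 / 3) * (y ^ 2 / 3) := by rw [hy4]
    _ ≤ (m + 2) ^ 2 / 2 - d * d := sub_le_sub_left hdd _
    _ ≤ (2 * (Real.sin y / y) + m) ^ 2 := key

/-- **(4.9)–(4.10) with an explicit constant.** For `n ≥ 1` and real `m` with `m + 2 = 0` or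
`(m+2)² ≥ 1` (e.g. `m` an integer):
`∫_{(0, 1/(8n)]} |sin(2πt)/(πt) + m|² dt ≥ (m+2)²/(32n)`. [cite: BaezDuarte2000, Prop. 4.5 (proof, (4.9)–(4.10)), p. 11] -/
theorem integral_Ioc_norm_sq_sincKernel_add_ge {n : ℕ} (hn : 1 ≤ n) {m : ℝ}
    (hm : m + 2 = 0 ∨ 1 ≤ (m + 2) ^ 2) :
    (m + 2) ^ 2 / (32 * n) ≤
      ∫ t in Ioc (0 : ℝ) (1 / (8 * n)), ‖sincKernel t + (m : ℂ)‖ ^ 2 := by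
  have hn1 : (1 : ℝ) ≤ n := by exact_mod_cast hn
  have hn0 : (0 : ℝ) < n := by linarith
  have hcont : Continuous fun t : ℝ ↦ ‖sincKernel t + (m : ℂ)‖ ^ 2 :=
    ((continuous_sincKernel.add continuous_const).norm).pow 2
  rcases hm with hs | hs
  · -- `m + 2 = 0`: the bound is `0`
    rw [hs]
    simp only [ne_eq, OfNat.ofNat_ne_zero, not_false_eq_true, zero_pow, zero_div]
    exact setIntegral_nonneg measurableSet_Ioc fun t _ ↦ by positivity
  · set δ : ℝ := 1 / (8 * n) with hδ
    have hδ0 : 0 < δ := by positivity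
    have hδle : δ ≤ 1 / 8 := by
      rw [hδ]
      exact div_le_div_of_nonneg_left (by norm_num) (by norm_num) (by linarith)
    have hint : IntegrableOn (fun t : ℝ ↦ ‖sincKernel t + (m : ℂ)‖ ^ 2) (Ioc 0 δ) :=
      hcont.integrableOn_Ioc
    have hK : 16 * π ^ 4 / 9 ≤ (456 : ℝ) := by
      have hπ4 : π ^ 4 ≤ 4 ^ 4 := pow_le_pow_left₀ Real.pi_pos.le Real.pi_le_four 4
      linarith
    -- pointwise lower bound by a constant on `(0, δ]`
    have hpt : ∀ t ∈ Ioc (0 : ℝ) δ,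
        (m + 2) ^ 2 / 2 - 16 * π ^ 4 / 9 * δ ^ 4 ≤ ‖sincKernel t + (m : ℂ)‖ ^ 2 := by
      intro t ht
      have h1 := norm_sq_sincKernel_add_ge ht.1 m
      have ht4 : t ^ 4 ≤ δ ^ 4 := pow_le_pow_left₀ ht.1.le ht.2 4
      have : 16 * π ^ 4 / 9 * t ^ 4 ≤ 16 * π ^ 4 / 9 * δ ^ 4 :=
        mul_le_mul_of_nonneg_left ht4 (by positivity)
      linarith
    -- the constant is large enough
    have hKδ : 16 * π ^ 4 / 9 * δ ^ 4 ≤ (m + 2) ^ 2 / 4 := by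
      have h1 : 16 * π ^ 4 / 9 * δ ^ 4 ≤ 456 * δ ^ 4 :=
        mul_le_mul_of_nonneg_right hK (by positivity)
      have h2 : (456 : ℝ) * δ ^ 4 ≤ 456 * (1 / 8) ^ 4 :=
        mul_le_mul_of_nonneg_left (pow_le_pow_left₀ hδ0.le hδle 4) (by norm_num)
      have h3 : (456 : ℝ) * (1 / 8) ^ 4 ≤ 1 / 4 := by norm_num
      linarith
    calc (m + 2) ^ 2 / (32 * n) = δ * ((m + 2) ^ 2 / 4) := by
          rw [hδ]
          field_simp
          ring
      _ ≤ δ * ((m + 2) ^ 2 / 2 - 16 * π ^ 4 / 9 * δ ^ 4) := by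
          refine mul_le_mul_of_nonneg_left ?_ hδ0.le
          linarith
      _ = ∫ _ in Ioc (0 : ℝ) δ, ((m + 2) ^ 2 / 2 - 16 * π ^ 4 / 9 * δ ^ 4) := by
          rw [setIntegral_const, Real.volume_real_Ioc_of_le hδ0.le, sub_zero, smul_eq_mul]
      _ ≤ ∫ t in Ioc (0 : ℝ) δ, ‖sincKernel t + (m : ℂ)‖ ^ 2 :=
          setIntegral_mono_on (continuous_const.integrableOn_Ioc) hint measurableSet_Ioc hpt

/-! ## `∫_0^∞ |χ + S_n|² ≥ (M(n)+2)²/(32n)` through `U` -/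

/-- **(4.9): `‖χ + S_n‖₂² = ‖U(χ + S_n)‖₂² ≥ ∫_0^{1/(8n)} |sin(2πt)/(πt) + M(n)|² dt ≥ (M(n)+2)²/(32n)`**
(`n ≥ 1`), the isometry being the tree's
`Literature.NumberTheory.LFunctions.BaezDuarteU.integral_norm_sq_nbDual_eq`.
[cite: BaezDuarte2000, Prop. 4.5 (proof, (4.8)–(4.10)), p. 11] -/
theorem integral_norm_sq_nbFun_natural_ge {n : ℕ} (hn : 1 ≤ n) :
    (((mertensFunction n : ℤ) : ℝ) + 2) ^ 2 / (32 * n) ≤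
      ∫ t in Ioi (0 : ℝ), ‖nbFun (fun k : Fin n ↦ ((k : ℕ) : ℝ) + 1) (naturalCoeff n) t‖ ^ 2 := by
  have hn1 : (1 : ℝ) ≤ n := by exact_mod_cast hn
  have hn0 : (0 : ℝ) < n := by linarith
  rw [← integral_norm_sq_nbDual_eq _ _ (one_le_natDil n)]
  -- `M(n) + 2` is an integer: either `0` or of square `≥ 1`
  have hm : ((mertensFunction n : ℤ) : ℝ) + 2 = 0 ∨ 1 ≤ (((mertensFunction n : ℤ) : ℝ) + 2) ^ 2 := by
    rcases eq_or_ne (mertensFunction n + 2 : ℤ) 0 with h0 | h0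
    · left
      exact_mod_cast h0
    · right
      have h1 : (1 : ℤ) ≤ |mertensFunction n + 2| := Int.one_le_abs h0
      have h2 : (1 : ℝ) ≤ |((mertensFunction n : ℤ) : ℝ) + 2| := by exact_mod_cast h1
      calc (1 : ℝ) = 1 ^ 2 := by norm_num
        _ ≤ |((mertensFunction n : ℤ) : ℝ) + 2| ^ 2 := pow_le_pow_left₀ zero_le_one h2 2
        _ = (((mertensFunction n : ℤ) : ℝ) + 2) ^ 2 := sq_abs _
  calc (((mertensFunction n : ℤ) : ℝ) + 2) ^ 2 / (32 * n)
      ≤ ∫ t in Ioc (0 : ℝ) (1 / (8 * n)),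
          ‖sincKernel t + ((((mertensFunction n : ℤ) : ℝ) : ℝ) : ℂ)‖ ^ 2 :=
        integral_Ioc_norm_sq_sincKernel_add_ge hn hm
    _ = ∫ t in Ioc (0 : ℝ) (1 / (8 * n)),
          ‖nbDual (fun k : Fin n ↦ ((k : ℕ) : ℝ) + 1) (naturalCoeff n) t‖ ^ 2 := by
        refine setIntegral_congr_fun measurableSet_Ioc fun t ht ↦ ?_
        have htn : (n : ℝ) * t < 1 := by
          calc (n : ℝ) * t ≤ n * (1 / (8 * n)) := by gcongr; exact ht.2
            _ = 1 / 8 := by field_simp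
            _ < 1 := by norm_num
        rw [nbDual_natural_eq ht.1 htn, Complex.ofReal_intCast]
    _ ≤ ∫ t in Ioi (0 : ℝ), ‖nbDual (fun k : Fin n ↦ ((k : ℕ) : ℝ) + 1) (naturalCoeff n) t‖ ^ 2 :=
        setIntegral_mono_set (integrableOn_norm_sq_nbDual _ _ (one_le_natDil n))
          (Eventually.of_forall fun t ↦ by simp only [Pi.zero_apply]; positivity)
          (Eventually.of_forall fun t ht ↦ Ioc_subset_Ioi_self ht)

/-- **First half of Prop. 4.5 with `C = 1/√32`**: for `n ≥ 1`,
`‖χ + S_n‖_{L²(0,∞)} ≥ (1/√32) n^{-1/2} |M(n) + 2|`. [cite: BaezDuarte2000, Prop. 4.5 (4.10), p. 11] -/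
theorem ofReal_mertens_le_naturalError {n : ℕ} (hn : 1 ≤ n) :
    ENNReal.ofReal (1 / Real.sqrt 32 / Real.sqrt n * |(mertensFunction n : ℝ) + 2|) ≤
      naturalError n := by
  have hn1 : (1 : ℝ) ≤ n := by exact_mod_cast hn
  have hn0 : (0 : ℝ) < n := by linarith
  rw [naturalError_eq_genError, BDBLS2000.genError_eq _ _ (one_le_natDil n)]
  refine ENNReal.ofReal_le_ofReal (Real.le_sqrt_of_sq_le ?_)
  calc (1 / Real.sqrt 32 / Real.sqrt n * |((mertensFunction n : ℤ) : ℝ) + 2|) ^ 2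
      = (((mertensFunction n : ℤ) : ℝ) + 2) ^ 2 / (32 * n) := by
        rw [mul_pow, div_pow, div_pow, one_pow, Real.sq_sqrt (by norm_num), Real.sq_sqrt hn0.le,
          sq_abs]
        field_simp
    _ ≤ ∫ t in Ioi (0 : ℝ), ‖nbFun (fun k : Fin n ↦ ((k : ℕ) : ℝ) + 1) (naturalCoeff n) t‖ ^ 2 :=
        integral_norm_sq_nbFun_natural_ge hn

end BaezDuarte2000Prop45

/-! ## The discharge -/

/-- **Báez-Duarte 2000, Proposition 4.5, proved**: with `C = 1/√32 > 0`, for every `n ≥ 1`,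
`‖χ + S_n‖_{L²(0,∞)} ≥ max( C n^{-1/2} |M(n) + 2|, |g(n)| √n )`. The second half is the tree's
`ofReal_moebiusHarmonic_le_naturalError` (`χ + S_n = g(n)/x` on `(1/n,∞)`); the first is (4.8)–(4.10)
through Báez-Duarte's unitary `U` realised by Mellin–Plancherel
(`BaezDuarte2000Prop45.ofReal_mertens_le_naturalError`). [cite: BaezDuarte2000, Prop. 4.5, p. 11] -/
theorem BaezDuarte2000_prop4_5_holds : BaezDuarte2000_prop4_5 := by
  refine ⟨1 / Real.sqrt 32, by positivity, fun n hn ↦ ?_⟩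
  rw [ENNReal.ofReal_max]
  exact max_le (BaezDuarte2000Prop45.ofReal_mertens_le_naturalError hn)
    (ofReal_moebiusHarmonic_le_naturalError hn)

end Literature.Barriers.RiemannHypothesis
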